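import Literature.Analysis.FluidPDE.NormalisedPressureDischarge
import HarnessLib

/-!
# Tao's pressure normalisation (Lemma 4.1 (i)) for every viscosity `ν ≥ 0` — Euler included

Analysis/FluidPDE **proofs file** (theorems only: no definitions, no named facts, no `sorry`).

The tree's named fact `tao_pressure_normalisation` (Tao 2013, Lemma 4.1 (i); file
`NormalisedPressure.lean`) quantifies `ν > 0`, as printed, and is discharged in
`NormalisedPressureDischarge.lean` (`tao_pressure_normalisation_holds`). As recorded in that file's
docstrings, the viscosity enters Tao's probe argument only through a term `ν · O(R⁻²)`, and the
load-bearing lemma `pressure_sub_pressurePotential_eq` is stated there for `0 ≤ ν`. This file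
re-assembles the conclusion for **every `ν ≥ 0`**: for a classical finite-energy solution of the
unforced system `∂ₜu + (u·∇)u = νΔu − ∇p`, `div u = 0` on `[0, T] × ℝ³` — the incompressible Euler
equations when `ν = 0` — the pressure is the normalised pressure `-Δ⁻¹∂ᵢ∂ⱼ(uᵢuⱼ)` up to a bounded
measurable function of time, for a.e. (indeed every interior) `t`.

* `IsClassicalNSSolutionOn.pressure_normalisation_of_nonneg_viscosity` — the statement of
  `tao_pressure_normalisation` with `0 < ν` replaced by `0 ≤ ν`.

It is the input that makes Leray's energy identity available for smooth finite-energy EULER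
solutions in the tree's vocabulary (`ClassicalNSEnergyEqualityNonnegViscosity.lean`).

## References

* T. Tao, *Localisation and compactness properties of the Navier–Stokes global regularity
  problem*, Anal. PDE 6 (2013) 25–107 = arXiv:1108.1165: §4, Lemma 4.1 (i) and its proof. [Tao2011]
-/

noncomputable section

open MeasureTheory Set Filter Metric Topology Function
open scoped ENNReal RealInnerProductSpace ContDiff

namespace Literature.Analysis.FluidPDE

variable {ν T : ℝ} {u : ℝ → EuclideanSpace ℝ (Fin 3) → EuclideanSpace ℝ (Fin 3)}
  {p : ℝ → EuclideanSpace ℝ (Fin 3) → ℝ}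

/-- **Tao 2011, Lemma 4.1 (i), homogeneous case, for every viscosity `ν ≥ 0` (Euler included).**
For a classical finite-energy solution of the unforced system on `[0, T] × ℝ³` with `0 ≤ ν`, the
pressure is the normalised pressure `-Δ⁻¹∂ᵢ∂ⱼ(uᵢuⱼ)` up to a bounded measurable function of time,
for a.e. `t ∈ [0, T]`. Proof = the assembly of `tao_pressure_normalisation_holds` verbatim
(`p = Q[u] + h`, `∇h(t) = 0` at interior times by `pressure_sub_pressurePotential_eq`, which is
stated for `0 ≤ ν`; `Q[u(t)] = normalisedPressure (u t)`; `C(t) = p(t,0) − Q[u(t)](0)` clamped in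
`t`). [cite: Tao2011, Lemma 4.1 (i)] -/
theorem IsClassicalNSSolutionOn.pressure_normalisation_of_nonneg_viscosity (hν : 0 ≤ ν) (hT : 0 < T)
    (hsol : FluidPDE.IsClassicalNSSolutionOn (Icc 0 T) ν 0 u p)
    (hEn : ∃ C : ℝ≥0∞, C < ⊤ ∧ ∀ t ∈ Icc 0 T, ∫⁻ x, ‖u t x‖ₑ ^ 2 ≤ C) :
    ∃ C : ℝ → ℝ, Measurable C ∧ (∃ M : ℝ, ∀ t ∈ Icc 0 T, |C t| ≤ M) ∧
      ∀ᵐ t ∂(volume.restrict (Icc 0 T)), ∀ x, p t x = normalisedPressure (u t) x + C t := by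
  obtain ⟨Cₑ, hCₑ, hCle⟩ := hEn
  -- the energy in real form
  have hint : ∀ t ∈ Icc 0 T, Integrable fun y => ‖u t y‖ ^ 2 := fun t ht =>
    integrable_sq_of_lintegral_enorm_sq_lt_top (hsol.contDiff_velocity ht).continuous
      ((hCle t ht).trans_lt hCₑ)
  have hE : ∀ t ∈ Icc 0 T, ∫ y, ‖u t y‖ ^ 2 ≤ Cₑ.toReal := fun t ht => by
    have h1 := hCle t ht
    rw [← ofReal_integral_norm_sq_eq_lintegral (hint t ht)] at h1
    exact (ENNReal.ofReal_le_iff_le_toReal hCₑ.ne).1 h1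
  have hE0 : 0 ≤ Cₑ.toReal := ENNReal.toReal_nonneg
  -- the normalising constant, clamped in time
  refine ⟨fun t => p (max 0 (min t T)) 0 - pressurePotential (u (max 0 (min t T))) 0, ?_, ?_, ?_⟩
  · -- measurability
    have hp : Continuous fun t => p (max 0 (min t T)) 0 :=
      hsol.smooth_pressure.continuousOn.comp_continuous
        ((continuous_clamp T).prodMk (continuous_const (y := (0 : EuclideanSpace ℝ (Fin 3)))))
        fun t => mk_mem_prod (clamp_mem hT.le t) (mem_univ _)
    exact hp.measurable.sub (measurable_pressurePotential_clamp hT hsol.smooth_velocity)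
  · -- boundedness on `[0, T]`
    obtain ⟨Mp, hMp⟩ := hsol.smooth_pressure.exists_bound isCompact_Icc
      (isCompact_singleton (x := (0 : EuclideanSpace ℝ (Fin 3))))
    obtain ⟨MQ, hMQ⟩ := exists_bound_pressurePotential hT hsol.smooth_velocity hint hE
    refine ⟨Mp + MQ, fun t ht => ?_⟩
    show |p (max 0 (min t T)) 0 - pressurePotential (u (max 0 (min t T))) 0| ≤ Mp + MQ
    rw [clamp_eq ht]
    calc |p t 0 - pressurePotential (u t) 0| ≤ |p t 0| + |pressurePotential (u t) 0| := abs_sub _ _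
      _ ≤ Mp + MQ := add_le_add (by rw [← Real.norm_eq_abs]; exact hMp t ht 0 rfl) (hMQ t ht)
  · -- the identity, for a.e. (every interior) time
    have h1 : ∀ᵐ t ∂((volume : Measure ℝ).restrict (Icc 0 T)), t ∈ Icc 0 T :=
      ae_restrict_mem measurableSet_Icc
    have h2 : ∀ᵐ t ∂(volume : Measure ℝ), t ∉ ({0} : Set ℝ) ∧ t ∉ ({T} : Set ℝ) :=
      (measure_eq_zero_iff_ae_notMem.1 (measure_singleton 0)).and
        (measure_eq_zero_iff_ae_notMem.1 (measure_singleton T))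
    filter_upwards [h1, ae_restrict_of_ae h2] with t ht hne
    have htIoo : t ∈ Ioo 0 T := by
      simp only [mem_singleton_iff] at hne
      exact ⟨lt_of_le_of_ne ht.1 (Ne.symm hne.1), lt_of_le_of_ne ht.2 hne.2⟩
    intro x
    have hu2 : ContDiff ℝ 2 (u t) := contDiff_infty.1 (hsol.contDiff_velocity ht) 2
    rw [clamp_eq ht, normalisedPressure_eq_pressurePotential hu2 (hint t ht) x]
    have := pressure_sub_pressurePotential_eq hν hsol hE0 hint hE htIoo x
    linarith

end Literature.Analysis.FluidPDE

end
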